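import Literature.AlgebraicGeometry.Morphisms.SectionConormalHom   -- ★ `sectionConormalHom`, `pullbackAlgHom`, `exists_sectionAug_eq_one_and_basicOpen_le_preimage` (brings `SectionConormalChart`, `augCotangentLocalizationEquiv`)
import Mathlib.LinearAlgebra.Charpoly.Basic
import HarnessLib

/-!
# The composition law of the conormal maps of sections, independence of the chart, and of the shrinking element
# (Görtz–Wedhorn II (17.3) «does not depend on the choice of `U`», Remark 17.14 «functorial in the square»)

Topic `Literature/AlgebraicGeometry/Morphisms`, namespace `Literature.AlgebraicGeometry.Morphisms`.  THEOREMS ONLY (no definition, no instance, no notation, no named fact,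
no `sorry`); any commutative base ring `R` (no locality, no flatness, no noetherian hypothesis).  Sequel of ★ `Morphisms/SectionConormalHom`, whose docstring lists as «NOT HERE»
exactly what this file proves: the COMPOSITION LAW `w(u) ∘ w(u') = w(u ≫ u')` of the conormal maps `w(u) = sectionConormalHom … u …` along `R`-morphisms compatible with sections
(three schemes, three charts, three independent shrinking elements), and its corollaries — INDEPENDENCE of the shrinking element `h`, INDEPENDENCE of the affine chart `W`
(any two charts of the section give CONJUGATE `(I∕I², γ_v)`), hence equality of the characteristic polynomials of `γ_v = sectionConormalEndo … v …` read on any two charts with free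
finite conormal module.  Cell `pub/hodgecm-mathlib` (D-0151), programme P6 «MOD», ROW 3 organ **L3.1∕L3.2** (F0P6a-plan (g0) CENSUS-P6a v1 §(vi): the Kottwitz condition is typed
CHART-LOCALLY «for every affine chart on which `Lie` is free» — this file is what makes that typing independent of the chart), brick **(D2c-i)** of A-p01 (g22); kit author A-p07 (g17).
HONEST LABEL: HC_CM is proved only modulo the cell's 2 remaining named inputs (hLiu418 24832, h413 24833) until rung 0 closes; this file is unconditional (`--supports stmt-HodgeConjecture-24832`).

THE ARGUMENT (all maps are `Ideal.mapCotangent` of `R`-algebra maps between chart rings `Γ(·, W)` — Mathlib's `Scheme.Hom.appLE` — followed by inverses of the localisation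
isomorphisms ★ `augCotangentLocalizationEquiv`; the only geometry is `appLE` functoriality).  For `u : X → Y`, `u' : Y → Z` over `Spec R` compatible with the sections, charts
`W_X, W_Y, W_Z` and shrinking elements `h` (`D(h) ⊆ W_X ∩ u⁻¹W_Y`), `h'` (`D(h') ⊆ W_Y ∩ u'⁻¹W_Z`), `h''` (`D(h'') ⊆ W_X ∩ (u ≫ u')⁻¹W_Z`): pick `h₃ ∈ Γ(W_X)` with `e^♯h₃ = 1` and
`D(h₃) ⊆ u⁻¹D(h')` (★ `exists_sectionAug_eq_one_and_basicOpen_le`), put `g := h·h''·h₃`; the restriction `I_X∕I_X² → I_{D(g)}∕I_{D(g)}²` is injective (★ localisation iso), and after it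
both `w(u)(w(u') x)` and `w(u ≫ u') x` become the class of `(u ≫ u')^♯ s` in `Γ(X, D(g))` (§2 `appLE` bookkeeping), whence §3 **`sectionConormalHom_comp`**.  With `u' = 𝟙` ∕ `u = 𝟙`
and `sectionConormalEndo_id` (§4, `γ_{𝟙} = id` on any chart) this gives `sectionConormal{Hom,Endo}_eq_of_shrink` (independence of `h`); the comparison of two charts is the ★ map
`sectionConormalHom … (𝟙 X) …`, proved bijective (`sectionConormalHom_id_bijective`) and intertwining (`sectionConormalEndo_comp_sectionConormalHom_id`), whence §5
**`charpoly_sectionConormalEndo_eq_of_charts`** and the transports `free_∕finite_cotangent_sectionAug_of_chart`.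

## References
* [GortzWedhorn2023] U. Görtz, T. Wedhorn, *Algebraic Geometry II* (2023): (17.3) (17.3.1) and the paragraph after it («independent of `U`»), Remark 17.14 (functoriality in the square), Remark 17.15 (1).
* [EGAIV4] A. Grothendieck, J. Dieudonné, *EGA IV₄* (1967): (16.2.3), (16.4.1) (conormal sheaf of an immersion, functoriality).
* [Kottwitz1992] R. E. Kottwitz, JAMS 5 (1992): §5 p. 390 (the determinant condition, read affine-locally).
-/

set_option autoImplicit false

noncomputable section

-- `TopCat.Presheaf` is not reducible (as in ★ `Morphisms/SectionConormalChart`).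
set_option backward.isDefEq.respectTransparency false

open CategoryTheory AlgebraicGeometry TopologicalSpace Opposite
open Literature.RingTheory.Smooth

universe u

namespace Literature.AlgebraicGeometry.Morphisms

open ChartRing

/-! ## §1 Applied `appLE` identities (the private helpers of ★ `SectionConormalChart`, re-derived) -/

section AppLE

variable {X' Y Z : Scheme.{u}}

/-- `f^♯_{V ≤ W} (g^♯_{U ≤ V} x) = (f ≫ g)^♯_{U ≤ W} x` (Mathlib `Scheme.Hom.appLE_comp_appLE`, applied). [cite: GortzWedhorn2023, (17.3)] -/
theorem appLE_appLE_apply' (f : X' ⟶ Y) (g : Y ⟶ Z) (U : Z.Opens) (V : Y.Opens) (W : X'.Opens)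
    (e₁ : V ≤ g ⁻¹ᵁ U) (e₂ : W ≤ f ⁻¹ᵁ V) (x : Γ(Z, U)) :
    f.appLE V W e₂ (g.appLE U V e₁ x) = (f ≫ g).appLE U W (e₂.trans ((Opens.map f.base).map (homOfLE e₁)).le) x := by
  have := congrArg (fun φ => φ.hom x) (Scheme.Hom.appLE_comp_appLE f g U V W e₁ e₂)
  simpa only [CommRingCat.hom_comp, RingHom.comp_apply] using this

/-- `appLE` along equal morphisms (proof-irrelevant transport). [cite: GortzWedhorn2023, (17.3)] -/
theorem appLE_congr_hom' {g g' : Y ⟶ Z} (hg : g = g') (U : Z.Opens) (V : Y.Opens) (hUV : V ≤ g ⁻¹ᵁ U) (hUV' : V ≤ g' ⁻¹ᵁ U) (x : Γ(Z, U)) :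
    g.appLE U V hUV x = g'.appLE U V hUV' x := by
  subst hg; rfl

end AppLE

/-! ## §2 Ring-map bookkeeping on the charts -/

section Charts

variable {R : Type u} [CommRing R] {X Y Z : Scheme.{u}} (fX : X ⟶ Spec (.of R)) (fY : Y ⟶ Spec (.of R)) (fZ : Z ⟶ Spec (.of R))
  (eX : Spec (.of R) ⟶ X) (heX : eX ≫ fX = 𝟙 _) (eY : Spec (.of R) ⟶ Y) (heY : eY ≫ fY = 𝟙 _) (eZ : Spec (.of R) ⟶ Z) (heZ : eZ ≫ fZ = 𝟙 _)
  {WX : X.Opens} (heWX : eX ⁻¹ᵁ WX = ⊤) {WY : Y.Opens} (heWY : eY ⁻¹ᵁ WY = ⊤) {WZ : Z.Opens} (heWZ : eZ ⁻¹ᵁ WZ = ⊤)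

/-- **`appLE` composition for `pullbackAlgHom`s**: `(𝟙)^♯_{D(h₀) → D(g)} ∘ u^♯_{W_Y → D(h₀)} = u^♯_{W_Y → D(g)}` for `D(g) ⊆ D(h₀)` (values). [cite: GortzWedhorn2023, Remark 17.14] -/
theorem val_pullbackAlgHom_id_pullbackAlgHom (u : X ⟶ Y) (hu : u ≫ fY = fX) (h₀ g : ChartRing fX WX) (hh₀u : X.basicOpen (val h₀) ≤ u ⁻¹ᵁ WY)
    (hg : X.basicOpen (val g) ≤ (𝟙 X) ⁻¹ᵁ X.basicOpen (val h₀)) (s : ChartRing fY WY) :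
    val (pullbackAlgHom fX fX (𝟙 X) (Category.id_comp fX) g hg (pullbackAlgHom fX fY u hu h₀ hh₀u s)) =
      val (pullbackAlgHom fX fY u hu g ((show X.basicOpen (val g) ≤ X.basicOpen (val h₀) from hg).trans hh₀u) s) := by
  rw [val_pullbackAlgHom, val_pullbackAlgHom, val_pullbackAlgHom, appLE_appLE_apply']
  exact appLE_congr_hom' (Category.id_comp u) _ _ _ _ _

/-- **`appLE` composition along `u ≫ u'`**: `u^♯_{D(h') → D(g)} (u'^♯_{W_Z → D(h')} s) = (u ≫ u')^♯_{W_Z → D(g)} s` (values). [cite: GortzWedhorn2023, Remark 17.14] -/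
theorem val_pullbackAlgHom_pullbackAlgHom (u : X ⟶ Y) (hu : u ≫ fY = fX) (u' : Y ⟶ Z) (hu' : u' ≫ fZ = fY) (h' : ChartRing fY WY) (hh'u' : Y.basicOpen (val h') ≤ u' ⁻¹ᵁ WZ)
    (g : ChartRing fX WX) (hgu : X.basicOpen (val g) ≤ u ⁻¹ᵁ Y.basicOpen (val h')) (hgZ : X.basicOpen (val g) ≤ (u ≫ u') ⁻¹ᵁ WZ) (s : ChartRing fZ WZ) :
    val (pullbackAlgHom fX fY u hu g hgu (pullbackAlgHom fY fZ u' hu' h' hh'u' s)) =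
      val (pullbackAlgHom fX fZ (u ≫ u') (by rw [Category.assoc, hu', hu]) g hgZ s) := by
  rw [val_pullbackAlgHom, val_pullbackAlgHom, val_pullbackAlgHom, appLE_appLE_apply']

/-- The restriction `(𝟙)^♯_{W_Y → D(g)}` after `u^♯`: `(𝟙)^♯_{D(h₀) → D(g)} ∘ (restriction W → D(h₀)) = restriction W → D(g)` — the special case `u = 𝟙` of the first identity,
spelled with the localisation structure map `algebraMap Γ(W) Γ(D(h₀))`. [cite: GortzWedhorn2023, (17.3)] -/
theorem val_pullbackAlgHom_id_algebraMap (h₀ g : ChartRing fX WX) (hg : X.basicOpen (val g) ≤ (𝟙 X) ⁻¹ᵁ X.basicOpen (val h₀)) (s : ChartRing fX WX) :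
    val (pullbackAlgHom fX fX (𝟙 X) (Category.id_comp fX) g hg (algebraMap (ChartRing fX WX) (ChartRing fX (X.basicOpen (val h₀))) s)) =
      val (algebraMap (ChartRing fX WX) (ChartRing fX (X.basicOpen (val g))) s) := by
  rw [val_pullbackAlgHom, val_algebraMap_basicOpen, val_algebraMap_basicOpen]
  change ((Scheme.Hom.appLE (𝟙 X) (X.basicOpen (val h₀)) (X.basicOpen (val g)) hg).hom) (X.presheaf.map (homOfLE (X.basicOpen_le (val h₀))).op (val s)) = _
  rw [Scheme.Hom.appLE, Scheme.Hom.id_app, Category.id_comp, ← CommRingCat.comp_apply, ← X.presheaf.map_comp]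
  rfl

end Charts

/-! ## §3 The composition law `w(u) ∘ w(u') = w(u ≫ u')` -/

section Comp

variable {R : Type u} [CommRing R] {X Y Z : Scheme.{u}} (fX : X ⟶ Spec (.of R)) (fY : Y ⟶ Spec (.of R)) (fZ : Z ⟶ Spec (.of R))
  (eX : Spec (.of R) ⟶ X) (heX : eX ≫ fX = 𝟙 _) (eY : Spec (.of R) ⟶ Y) (heY : eY ≫ fY = 𝟙 _) (eZ : Spec (.of R) ⟶ Z) (heZ : eZ ≫ fZ = 𝟙 _)
  {WX : X.Opens} (heWX : eX ⁻¹ᵁ WX = ⊤) {WY : Y.Opens} (heWY : eY ⁻¹ᵁ WY = ⊤) {WZ : Z.Opens} (heWZ : eZ ⁻¹ᵁ WZ = ⊤)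
  (hWX : IsAffineOpen WX) (hWY : IsAffineOpen WY)
  (u : X ⟶ Y) (hu : u ≫ fY = fX) (heu : eX ≫ u = eY) (u' : Y ⟶ Z) (hu' : u' ≫ fZ = fY) (heu' : eY ≫ u' = eZ)
  (h : ChartRing fX WX) (hhu : X.basicOpen (val h) ≤ u ⁻¹ᵁ WY) (hh : sectionAug fX eX heX heWX h = 1)
  (h' : ChartRing fY WY) (hh'u' : Y.basicOpen (val h') ≤ u' ⁻¹ᵁ WZ) (hh' : sectionAug fY eY heY heWY h' = 1)
  (h'' : ChartRing fX WX) (hh''u : X.basicOpen (val h'') ≤ (u ≫ u') ⁻¹ᵁ WZ) (hh'' : sectionAug fX eX heX heWX h'' = 1)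

include hu hu' in
/-- `(u ≫ u') ≫ f_Z = f_X`. [cite: GortzWedhorn2023, Remark 17.14] -/
theorem comp_comp_structure_eq : (u ≫ u') ≫ fZ = fX := by rw [Category.assoc, hu', hu]

include heu heu' in
/-- `e_X ≫ (u ≫ u') = e_Z`. [cite: GortzWedhorn2023, Remark 17.14] -/
theorem section_comp_comp_eq : eX ≫ (u ≫ u') = eZ := by rw [← Category.assoc, heu, heu']

/-- **READING `w(u)` AFTER A FURTHER RESTRICTION.**  For `D(g) ⊆ D(h₀)` with `e^♯ g = 1`: the restriction `I_X∕I_X² → I_{D(g)}∕I_{D(g)}²` (★ `augCotangentLocalizationEquiv` at `g`) sends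
`w(u)_{(W_X, h₀)} x` to the class `mapCotangent (u^♯_{W_Y → D(g)}) x`. [cite: GortzWedhorn2023, Remark 17.14 and (17.3)] -/
theorem augCotangentLocalizationEquiv_sectionConormalHom_of_le (h₀ : ChartRing fX WX) (hh₀u : X.basicOpen (val h₀) ≤ u ⁻¹ᵁ WY) (hh₀ : sectionAug fX eX heX heWX h₀ = 1)
    (g : ChartRing fX WX) (hg : sectionAug fX eX heX heWX g = 1) (hgle : X.basicOpen (val g) ≤ X.basicOpen (val h₀))
    (x : (augIdeal (sectionAug fY eY heY heWY)).Cotangent) :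
    haveI := ChartRing.isLocalization_away fX hWX g
    augCotangentLocalizationEquiv (sectionAug fX eX heX heWX) (sectionAug fX eX heX (preimage_basicOpen_eq_top fX eX heX heWX g hg))
        (sectionAug_algebraMap fX eX heX heWX g hg) g hg (sectionConormalHom fX fY eX heX eY heY heWX heWY u hu heu h₀ hh₀u hWX hh₀ x) =
      (augIdeal (sectionAug fY eY heY heWY)).mapCotangent _ (pullbackAlgHom fX fY u hu g (hgle.trans hh₀u))
        (augIdeal_le_comap_pullbackAlgHom fX fY eX heX eY heY heWX heWY u hu heu g (hgle.trans hh₀u) hg) x := by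
  haveI := ChartRing.isLocalization_away fX hWX g
  haveI := ChartRing.isLocalization_away fX hWX h₀
  have hg' : X.basicOpen (val g) ≤ (𝟙 X) ⁻¹ᵁ X.basicOpen (val h₀) := hgle
  -- write `x = [s]`, `w(u) x = [z]` with `z ∈ I_X`; the defining property at `h₀`: `res_{h₀} z ≡ u^♯_{h₀} s (mod I_{D(h₀)}²)`
  obtain ⟨s, rfl⟩ := Ideal.toCotangent_surjective _ x
  obtain ⟨z, hz⟩ := Ideal.toCotangent_surjective _
    (sectionConormalHom fX fY eX heX eY heY heWX heWY u hu heu h₀ hh₀u hWX hh₀ ((augIdeal (sectionAug fY eY heY heWY)).toCotangent s))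
  have hz' := congrArg (augCotangentLocalizationEquiv (sectionAug fX eX heX heWX) (sectionAug fX eX heX (preimage_basicOpen_eq_top fX eX heX heWX h₀ hh₀))
    (sectionAug_algebraMap fX eX heX heWX h₀ hh₀) h₀ hh₀) hz
  rw [augCotangentLocalizationEquiv_sectionConormalHom, augCotangentLocalizationEquiv_toCotangent, Ideal.mapCotangent_toCotangent,
    Ideal.toCotangent_eq] at hz'
  -- push the congruence along `ρ = (𝟙)^♯ : Γ(D(h₀)) → Γ(D(g))`, which maps `I_{D(h₀)}` into `I_{D(g)}`
  set ρ := pullbackAlgHom fX fX (𝟙 X) (Category.id_comp fX) g hg' with hρ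
  have hρI : augIdeal (sectionAug fX eX heX (preimage_basicOpen_eq_top fX eX heX heWX h₀ hh₀)) ≤
      (augIdeal (sectionAug fX eX heX (preimage_basicOpen_eq_top fX eX heX heWX g hg))).comap ρ :=
    augIdeal_le_comap_pullbackAlgHom fX fX eX heX eX heX heWX
      (preimage_basicOpen_eq_top fX eX heX heWX h₀ hh₀) (𝟙 X) (Category.id_comp fX) (Category.comp_id eX) g hg' hg
  have hmap : Ideal.map ρ (augIdeal (sectionAug fX eX heX (preimage_basicOpen_eq_top fX eX heX heWX h₀ hh₀)) ^ 2) ≤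
      augIdeal (sectionAug fX eX heX (preimage_basicOpen_eq_top fX eX heX heWX g hg)) ^ 2 := by
    rw [Ideal.map_pow]
    exact Ideal.pow_right_mono (Ideal.map_le_iff_le_comap.2 hρI) 2
  have hmem := hmap (Ideal.mem_map_of_mem ρ hz')
  rw [map_sub] at hmem
  have e1 : ρ (algebraMap (ChartRing fX WX) (ChartRing fX (X.basicOpen (val h₀))) (z : ChartRing fX WX)) =
      algebraMap (ChartRing fX WX) (ChartRing fX (X.basicOpen (val g))) (z : ChartRing fX WX) :=
    val_injective fX _ (val_pullbackAlgHom_id_algebraMap fX h₀ g hg' (z : ChartRing fX WX))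
  have e2 : ρ (pullbackAlgHom fX fY u hu h₀ hh₀u (s : ChartRing fY WY)) = pullbackAlgHom fX fY u hu g (hgle.trans hh₀u) (s : ChartRing fY WY) :=
    val_injective fX _ (val_pullbackAlgHom_id_pullbackAlgHom fX fY u hu h₀ g hh₀u hg' (s : ChartRing fY WY))
  rw [e1, e2] at hmem
  -- conclude at `g`
  rw [← hz, augCotangentLocalizationEquiv_toCotangent, Ideal.mapCotangent_toCotangent, Ideal.toCotangent_eq]
  exact hmem

/-- **READING `w(u)` AFTER A PULL-BACK ALONG `t : T → X`** (the general form of the previous lemma): for a third `R`-scheme `T` with section `e_T`, `t : T → X` with `e_T ≫ t = e_X`,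
and `g ∈ Γ(T, W_T)` with `e_T^♯ g = 1`, `D(g) ⊆ t⁻¹D(h₀)`: `mapCotangent (t^♯_{W_X → D(g)}) (w(u)_{(W_X,h₀)} x) = mapCotangent ((t ≫ u)^♯_{W_Y → D(g)}) x`.
[cite: GortzWedhorn2023, Remark 17.14] -/
theorem mapCotangent_pullbackAlgHom_sectionConormalHom {T : Scheme.{u}} (fT : T ⟶ Spec (.of R)) (eT : Spec (.of R) ⟶ T) (heT : eT ≫ fT = 𝟙 _)
    {WT : T.Opens} (heWT : eT ⁻¹ᵁ WT = ⊤) (t : T ⟶ X) (ht : t ≫ fX = fT) (het : eT ≫ t = eX)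
    (h₀ : ChartRing fX WX) (hh₀u : X.basicOpen (val h₀) ≤ u ⁻¹ᵁ WY) (hh₀ : sectionAug fX eX heX heWX h₀ = 1)
    (g : ChartRing fT WT) (hg : sectionAug fT eT heT heWT g = 1) (hgt : T.basicOpen (val g) ≤ t ⁻¹ᵁ X.basicOpen (val h₀))
    (x : (augIdeal (sectionAug fY eY heY heWY)).Cotangent) :
    (augIdeal (sectionAug fX eX heX heWX)).mapCotangent _ (pullbackAlgHom fT fX t ht g (hgt.trans ((Opens.map t.base).map (homOfLE (X.basicOpen_le (val h₀)))).le))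
        (augIdeal_le_comap_pullbackAlgHom fT fX eT heT eX heX heWT heWX t ht het g _ hg)
        (sectionConormalHom fX fY eX heX eY heY heWX heWY u hu heu h₀ hh₀u hWX hh₀ x) =
      (augIdeal (sectionAug fY eY heY heWY)).mapCotangent _
        (pullbackAlgHom fT fY (t ≫ u) (by rw [Category.assoc, hu, ht]) g (hgt.trans ((Opens.map t.base).map (homOfLE hh₀u)).le))
        (augIdeal_le_comap_pullbackAlgHom fT fY eT heT eY heY heWT heWY (t ≫ u) (by rw [Category.assoc, hu, ht]) (by rw [← Category.assoc, het, heu]) g _ hg) x := by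
  haveI := ChartRing.isLocalization_away fX hWX h₀
  obtain ⟨s, rfl⟩ := Ideal.toCotangent_surjective _ x
  obtain ⟨z, hz⟩ := Ideal.toCotangent_surjective _
    (sectionConormalHom fX fY eX heX eY heY heWX heWY u hu heu h₀ hh₀u hWX hh₀ ((augIdeal (sectionAug fY eY heY heWY)).toCotangent s))
  have hz' := congrArg (augCotangentLocalizationEquiv (sectionAug fX eX heX heWX) (sectionAug fX eX heX (preimage_basicOpen_eq_top fX eX heX heWX h₀ hh₀))
    (sectionAug_algebraMap fX eX heX heWX h₀ hh₀) h₀ hh₀) hz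
  rw [augCotangentLocalizationEquiv_sectionConormalHom, augCotangentLocalizationEquiv_toCotangent, Ideal.mapCotangent_toCotangent,
    Ideal.toCotangent_eq] at hz'
  -- push along `ρ = t^♯ : Γ(X, D(h₀)) → Γ(T, D(g))`
  set ρ := pullbackAlgHom fT fX t ht g hgt with hρ
  have hρI : augIdeal (sectionAug fX eX heX (preimage_basicOpen_eq_top fX eX heX heWX h₀ hh₀)) ≤
      (augIdeal (sectionAug fT eT heT (preimage_basicOpen_eq_top fT eT heT heWT g hg))).comap ρ :=
    augIdeal_le_comap_pullbackAlgHom fT fX eT heT eX heX heWT (preimage_basicOpen_eq_top fX eX heX heWX h₀ hh₀) t ht het g hgt hg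
  have hmap : Ideal.map ρ (augIdeal (sectionAug fX eX heX (preimage_basicOpen_eq_top fX eX heX heWX h₀ hh₀)) ^ 2) ≤
      augIdeal (sectionAug fT eT heT (preimage_basicOpen_eq_top fT eT heT heWT g hg)) ^ 2 := by
    rw [Ideal.map_pow]
    exact Ideal.pow_right_mono (Ideal.map_le_iff_le_comap.2 hρI) 2
  have hmem := hmap (Ideal.mem_map_of_mem ρ hz')
  rw [map_sub] at hmem
  have e1 : ρ (algebraMap (ChartRing fX WX) (ChartRing fX (X.basicOpen (val h₀))) (z : ChartRing fX WX)) =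
      pullbackAlgHom fT fX t ht g (hgt.trans ((Opens.map t.base).map (homOfLE (X.basicOpen_le (val h₀)))).le) (z : ChartRing fX WX) := by
    apply val_injective fT
    rw [hρ, val_pullbackAlgHom, val_algebraMap_basicOpen, val_pullbackAlgHom]
    have := congrArg (fun φ => φ.hom (val (z : ChartRing fX WX))) (Scheme.Hom.map_appLE t hgt (homOfLE (X.basicOpen_le (val h₀))).op)
    simpa only [CommRingCat.hom_comp, RingHom.comp_apply] using this
  have e2 : ρ (pullbackAlgHom fX fY u hu h₀ hh₀u (s : ChartRing fY WY)) =
      pullbackAlgHom fT fY (t ≫ u) (by rw [Category.assoc, hu, ht]) g (hgt.trans ((Opens.map t.base).map (homOfLE hh₀u)).le) (s : ChartRing fY WY) :=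
    val_injective fT _ (by rw [hρ, val_pullbackAlgHom, val_pullbackAlgHom, val_pullbackAlgHom, appLE_appLE_apply'])
  rw [e1, e2] at hmem
  rw [← hz, Ideal.mapCotangent_toCotangent, Ideal.mapCotangent_toCotangent, Ideal.toCotangent_eq]
  exact hmem

include hh hh' hh'' heu' in
/-- **THE COMPOSITION LAW OF THE CONORMAL MAPS OF SECTIONS**: `w(u) ∘ w(u') = w(u ≫ u')` — for `R`-morphisms `u : X → Y`, `u' : Y → Z` compatible with the sections, affine charts
`W_X, W_Y` and any chart `W_Z` of the three sections, and ANY admissible shrinking elements `h` (for `u`), `h'` (for `u'`), `h''` (for `u ≫ u'`).  (Görtz–Wedhorn's «functorial in the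
square»; the tree's ★ `SectionConormalHom` docstring lists this law as not yet available.) [cite: GortzWedhorn2023, Remark 17.14 and (17.3)] [cite: EGAIV4, (16.2.3)] -/
theorem sectionConormalHom_comp :
    sectionConormalHom fX fY eX heX eY heY heWX heWY u hu heu h hhu hWX hh ∘ₗ sectionConormalHom fY fZ eY heY eZ heZ heWY heWZ u' hu' heu' h' hh'u' hWY hh' =
      sectionConormalHom fX fZ eX heX eZ heZ heWX heWZ (u ≫ u') (comp_comp_structure_eq fX fY fZ u hu u' hu') (section_comp_comp_eq eX eY eZ u heu u' heu') h'' hh''u hWX hh'' := by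
  -- a common basic open `D(g)`, `g = h·h''·h₃`, `D(h₃) ⊆ u⁻¹D(h')`
  obtain ⟨h₃, hh₃, hh₃le⟩ := exists_sectionAug_eq_one_and_basicOpen_le fX eX heX heWX hWX (u ⁻¹ᵁ Y.basicOpen (val h')) (by
    rw [← Scheme.Hom.comp_preimage, heu]; exact preimage_basicOpen_eq_top fY eY heY heWY h' hh')
  have hg : sectionAug fX eX heX heWX (h * h'' * h₃) = 1 := by rw [map_mul, map_mul, hh, hh'', hh₃, mul_one, mul_one]
  have hD : X.basicOpen (val (h * h'' * h₃)) = X.basicOpen (val h) ⊓ X.basicOpen (val h'') ⊓ X.basicOpen (val h₃) := by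
    rw [map_mul, map_mul, Scheme.basicOpen_mul, Scheme.basicOpen_mul]
  have hgh : X.basicOpen (val (h * h'' * h₃)) ≤ X.basicOpen (val h) := by rw [hD]; exact inf_le_left.trans inf_le_left
  have hgh'' : X.basicOpen (val (h * h'' * h₃)) ≤ X.basicOpen (val h'') := by rw [hD]; exact inf_le_left.trans inf_le_right
  have hgh₃ : X.basicOpen (val (h * h'' * h₃)) ≤ u ⁻¹ᵁ Y.basicOpen (val h') := by rw [hD]; exact inf_le_right.trans hh₃le
  haveI := ChartRing.isLocalization_away fX hWX (h * h'' * h₃)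
  apply LinearMap.ext
  intro x
  apply (augCotangentLocalizationEquiv (sectionAug fX eX heX heWX) (sectionAug fX eX heX (preimage_basicOpen_eq_top fX eX heX heWX _ hg))
    (sectionAug_algebraMap fX eX heX heWX _ hg) (h * h'' * h₃) hg).injective
  rw [LinearMap.comp_apply,
    augCotangentLocalizationEquiv_sectionConormalHom_of_le fX fY eX heX eY heY heWX heWY hWX u hu heu h hhu hh (h * h'' * h₃) hg hgh,
    augCotangentLocalizationEquiv_sectionConormalHom_of_le fX fZ eX heX eZ heZ heWX heWZ hWX (u ≫ u') (comp_comp_structure_eq fX fY fZ u hu u' hu')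
      (section_comp_comp_eq eX eY eZ u heu u' heu') h'' hh''u hh'' (h * h'' * h₃) hg hgh'',
    mapCotangent_pullbackAlgHom_sectionConormalHom fY fZ eY heY eZ heZ heWY heWZ hWY u' hu' heu' fX eX heX heWX u hu heu h' hh'u' hh' (h * h'' * h₃) hg hgh₃]

end Comp

/-! ## §4 Identity, congruence, independence of the shrinking element -/

section Identity

variable {R : Type u} [CommRing R] {X Y : Scheme.{u}} (fX : X ⟶ Spec (.of R)) (fY : Y ⟶ Spec (.of R))
  (eX : Spec (.of R) ⟶ X) (heX : eX ≫ fX = 𝟙 _) (eY : Spec (.of R) ⟶ Y) (heY : eY ≫ fY = 𝟙 _)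
  {WX : X.Opens} (heWX : eX ⁻¹ᵁ WX = ⊤) {WY : Y.Opens} (heWY : eY ⁻¹ᵁ WY = ⊤) (hWX : IsAffineOpen WX)

/-- `w` along EQUAL morphisms with the same charts and shrinking element agree (proof-irrelevant transport). [cite: GortzWedhorn2023, Remark 17.14] -/
theorem sectionConormalHom_congr {u u' : X ⟶ Y} (huu' : u = u') (hu : u ≫ fY = fX) (hu' : u' ≫ fY = fX) (heu : eX ≫ u = eY) (heu' : eX ≫ u' = eY)
    (h : ChartRing fX WX) (hhu : X.basicOpen (val h) ≤ u ⁻¹ᵁ WY) (hhu' : X.basicOpen (val h) ≤ u' ⁻¹ᵁ WY) (hh : sectionAug fX eX heX heWX h = 1) :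
    sectionConormalHom fX fY eX heX eY heY heWX heWY u hu heu h hhu hWX hh = sectionConormalHom fX fY eX heX eY heY heWX heWY u' hu' heu' h hhu' hWX hh := by
  subst huu'; rfl

/-- For `v = 𝟙`, ★ `restrictAlgHom` IS the localisation structure map `Γ(X, W) → Γ(X, D(h))`. [cite: GortzWedhorn2023, (17.3)] -/
theorem restrictAlgHom_id_eq (h : ChartRing fX WX) (hhv : X.basicOpen (val h) ≤ (𝟙 X) ⁻¹ᵁ WX) :
    restrictAlgHom fX (𝟙 X) (Category.id_comp fX) h hhv = IsScalarTower.toAlgHom R (ChartRing fX WX) (ChartRing fX (X.basicOpen (val h))) := by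
  apply AlgHom.ext
  intro s
  apply val_injective fX
  rw [val_restrictAlgHom, IsScalarTower.coe_toAlgHom', val_algebraMap_basicOpen]
  change (Scheme.Hom.appLE (𝟙 X) WX (X.basicOpen (val h)) hhv).hom (val s) = _
  rw [Scheme.Hom.appLE, Scheme.Hom.id_app]
  rfl

/-- **`γ_{𝟙} = id`**: the conormal endomorphism of the identity (any chart, any shrinking element) is the identity — its `mapCotangent` IS the localisation isomorphism
★ `augCotangentLocalizationEquiv`. [cite: GortzWedhorn2023, Remark 17.14 and (17.3)] -/
theorem sectionConormalEndo_id (h : ChartRing fX WX) (hhv : X.basicOpen (val h) ≤ (𝟙 X) ⁻¹ᵁ WX) (hh : sectionAug fX eX heX heWX h = 1) :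
    sectionConormalEndo fX eX heX heWX (𝟙 X) (Category.id_comp fX) (Category.comp_id eX) h hhv hWX hh = LinearMap.id := by
  haveI := ChartRing.isLocalization_away fX hWX h
  apply LinearMap.ext
  intro x
  have key : (augIdeal (sectionAug fX eX heX heWX)).mapCotangent _ (restrictAlgHom fX (𝟙 X) (Category.id_comp fX) h hhv)
        (augIdeal_le_comap_restrictAlgHom fX eX heX heWX (𝟙 X) (Category.id_comp fX) (Category.comp_id eX) h hhv hh) x =
      augCotangentLocalizationEquiv (sectionAug fX eX heX heWX) (sectionAug fX eX heX (preimage_basicOpen_eq_top fX eX heX heWX h hh))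
        (sectionAug_algebraMap fX eX heX heWX h hh) h hh x := by
    rw [← LinearEquiv.coe_coe, augCotangentLocalizationEquiv_toLinearMap]
    obtain ⟨y, rfl⟩ := Ideal.toCotangent_surjective _ x
    rw [Ideal.mapCotangent_toCotangent, Ideal.mapCotangent_toCotangent]
    congr 2
  rw [sectionConormalEndo, LinearMap.comp_apply, LinearEquiv.coe_toLinearMap, key, LinearEquiv.symm_apply_apply, LinearMap.id_apply]

/-- **`w(𝟙) = id` read on ONE chart** (any shrinking element). [cite: GortzWedhorn2023, (17.3)] -/
theorem sectionConormalHom_id_self (h : ChartRing fX WX) (hhv : X.basicOpen (val h) ≤ (𝟙 X) ⁻¹ᵁ WX) (hh : sectionAug fX eX heX heWX h = 1) :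
    sectionConormalHom fX fX eX heX eX heX heWX heWX (𝟙 X) (Category.id_comp fX) (Category.comp_id eX) h hhv hWX hh = LinearMap.id := by
  rw [sectionConormalHom_eq_sectionConormalEndo]
  exact sectionConormalEndo_id fX eX heX heWX hWX h hhv hh

/-- **INDEPENDENCE OF THE SHRINKING ELEMENT**: `w(u)` read through `D(h₁)` or through `D(h₂)` is the same map `I_Y∕I_Y² → I_X∕I_X²` (composition law with `u' = 𝟙`).
[cite: GortzWedhorn2023, (17.3) («independent of the choice») and Remark 17.14] -/
theorem sectionConormalHom_eq_of_shrink (u : X ⟶ Y) (hu : u ≫ fY = fX) (heu : eX ≫ u = eY)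
    (h₁ : ChartRing fX WX) (hh₁u : X.basicOpen (val h₁) ≤ u ⁻¹ᵁ WY) (hh₁ : sectionAug fX eX heX heWX h₁ = 1)
    (h₂ : ChartRing fX WX) (hh₂u : X.basicOpen (val h₂) ≤ u ⁻¹ᵁ WY) (hh₂ : sectionAug fX eX heX heWX h₂ = 1) :
    sectionConormalHom fX fY eX heX eY heY heWX heWY u hu heu h₁ hh₁u hWX hh₁ = sectionConormalHom fX fY eX heX eY heY heWX heWY u hu heu h₂ hh₂u hWX hh₂ := by
  -- `w(u)_{h₂} = w(𝟙 ≫ u)_{h₂} = w(𝟙)_{h₂} ∘ w(u)_{h₁} = w(u)_{h₁}`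
  have hcomp := sectionConormalHom_comp fX fX fY eX heX eX heX eY heY heWX heWX heWY hWX hWX (𝟙 X) (Category.id_comp fX) (Category.comp_id eX) u hu heu
    h₂ (X.basicOpen_le (val h₂)) hh₂ h₁ hh₁u hh₁ h₂ (by rw [Category.id_comp]; exact hh₂u) hh₂
  rw [sectionConormalHom_id_self fX eX heX heWX hWX, LinearMap.id_comp] at hcomp
  rw [hcomp]
  exact (sectionConormalHom_congr fX fY eX heX eY heY heWX heWY hWX (Category.id_comp u) _ hu _ heu h₂ _ hh₂u hh₂).symm

/-- **INDEPENDENCE OF THE SHRINKING ELEMENT for `γ_v = sectionConormalEndo`.** [cite: GortzWedhorn2023, (17.3) and Remark 17.14] -/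
theorem sectionConormalEndo_eq_of_shrink (v : X ⟶ X) (hv : v ≫ fX = fX) (hev : eX ≫ v = eX)
    (h₁ : ChartRing fX WX) (hh₁v : X.basicOpen (val h₁) ≤ v ⁻¹ᵁ WX) (hh₁ : sectionAug fX eX heX heWX h₁ = 1)
    (h₂ : ChartRing fX WX) (hh₂v : X.basicOpen (val h₂) ≤ v ⁻¹ᵁ WX) (hh₂ : sectionAug fX eX heX heWX h₂ = 1) :
    sectionConormalEndo fX eX heX heWX v hv hev h₁ hh₁v hWX hh₁ = sectionConormalEndo fX eX heX heWX v hv hev h₂ hh₂v hWX hh₂ := by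
  rw [← sectionConormalHom_eq_sectionConormalEndo, ← sectionConormalHom_eq_sectionConormalEndo]
  exact sectionConormalHom_eq_of_shrink fX fX eX heX eX heX heWX heWX hWX v hv hev h₁ hh₁v hh₁ h₂ hh₂v hh₂

end Identity

/-! ## §5 Independence of the chart: two affine charts of the section give conjugate `(I∕I², γ_v)` and equal characteristic polynomials -/

section TwoCharts

variable {R : Type u} [CommRing R] {X : Scheme.{u}} (f : X ⟶ Spec (.of R)) (e : Spec (.of R) ⟶ X) (he : e ≫ f = 𝟙 _)
  {W₁ W₂ : X.Opens} (heW₁ : e ⁻¹ᵁ W₁ = ⊤) (heW₂ : e ⁻¹ᵁ W₂ = ⊤) (hW₁ : IsAffineOpen W₁) (hW₂ : IsAffineOpen W₂)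
  (k₁ : ChartRing f W₁) (hk₁ : X.basicOpen (val k₁) ≤ (𝟙 X) ⁻¹ᵁ W₂) (hhk₁ : sectionAug f e he heW₁ k₁ = 1)
  (k₂ : ChartRing f W₂) (hk₂ : X.basicOpen (val k₂) ≤ (𝟙 X) ⁻¹ᵁ W₁) (hhk₂ : sectionAug f e he heW₂ k₂ = 1)

include hhk₁ hhk₂ hW₂ in
/-- **The comparison maps of two charts are mutually inverse**: `w(𝟙)_{W₁ ← W₂} ∘ w(𝟙)_{W₂ ← W₁} = id` (through shrinking elements `k₁ ∈ Γ(W₁)`, `D(k₁) ⊆ W₂`, and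
`k₂ ∈ Γ(W₂)`, `D(k₂) ⊆ W₁`, containing the section — they exist by ★ `exists_sectionAug_eq_one_and_basicOpen_le`). [cite: GortzWedhorn2023, (17.3)] -/
theorem sectionConormalHom_id_comp_sectionConormalHom_id :
    sectionConormalHom f f e he e he heW₁ heW₂ (𝟙 X) (Category.id_comp f) (Category.comp_id e) k₁ hk₁ hW₁ hhk₁ ∘ₗ
        sectionConormalHom f f e he e he heW₂ heW₁ (𝟙 X) (Category.id_comp f) (Category.comp_id e) k₂ hk₂ hW₂ hhk₂ = LinearMap.id := by
  rw [sectionConormalHom_comp f f f e he e he e he heW₁ heW₂ heW₁ hW₁ hW₂ (𝟙 X) (Category.id_comp f) (Category.comp_id e) (𝟙 X) (Category.id_comp f)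
      (Category.comp_id e) k₁ hk₁ hhk₁ k₂ hk₂ hhk₂ k₁ (by rw [Category.id_comp]; exact X.basicOpen_le (val k₁)) hhk₁,
    sectionConormalHom_congr f f e he e he heW₁ heW₁ hW₁ (Category.id_comp (𝟙 X)) _ (Category.id_comp f) _ (Category.comp_id e) k₁ _ (X.basicOpen_le (val k₁)) hhk₁,
    sectionConormalHom_id_self f e he heW₁ hW₁]

include hhk₁ hhk₂ hW₂ hk₂ in
/-- **The comparison map `I_{W₂}∕I² → I_{W₁}∕I²` of two affine charts of the section is BIJECTIVE.** [cite: GortzWedhorn2023, (17.3) («independent of `U`»)] -/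
theorem sectionConormalHom_id_bijective :
    Function.Bijective (sectionConormalHom f f e he e he heW₁ heW₂ (𝟙 X) (Category.id_comp f) (Category.comp_id e) k₁ hk₁ hW₁ hhk₁) := by
  have h12 := sectionConormalHom_id_comp_sectionConormalHom_id f e he heW₁ heW₂ hW₁ hW₂ k₁ hk₁ hhk₁ k₂ hk₂ hhk₂
  have h21 := sectionConormalHom_id_comp_sectionConormalHom_id f e he heW₂ heW₁ hW₂ hW₁ k₂ hk₂ hhk₂ k₁ hk₁ hhk₁
  refine ⟨Function.LeftInverse.injective (g := sectionConormalHom f f e he e he heW₂ heW₁ (𝟙 X) (Category.id_comp f) (Category.comp_id e) k₂ hk₂ hW₂ hhk₂)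
      (fun x => ?_), Function.RightInverse.surjective (g := sectionConormalHom f f e he e he heW₂ heW₁ (𝟙 X) (Category.id_comp f) (Category.comp_id e) k₂ hk₂ hW₂ hhk₂)
      (fun x => ?_)⟩
  · exact (LinearMap.congr_fun h21 x).trans rfl
  · exact (LinearMap.congr_fun h12 x).trans rfl

include hhk₁ in
/-- **The comparison map INTERTWINES the conormal endomorphisms of the two charts**: `γ_v^{W₁} ∘ c = c ∘ γ_v^{W₂}` for `c = w(𝟙)_{W₁ ← W₂}` and ANY `R`-endomorphism `v` fixing
the section, with arbitrary shrinking elements on either chart. [cite: GortzWedhorn2023, Remark 17.14 and (17.3)] -/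
theorem sectionConormalEndo_comp_sectionConormalHom_id (v : X ⟶ X) (hv : v ≫ f = f) (hev : e ≫ v = e)
    (h₁ : ChartRing f W₁) (hh₁v : X.basicOpen (val h₁) ≤ v ⁻¹ᵁ W₁) (hh₁ : sectionAug f e he heW₁ h₁ = 1)
    (h₂ : ChartRing f W₂) (hh₂v : X.basicOpen (val h₂) ≤ v ⁻¹ᵁ W₂) (hh₂ : sectionAug f e he heW₂ h₂ = 1) :
    sectionConormalEndo f e he heW₁ v hv hev h₁ hh₁v hW₁ hh₁ ∘ₗ sectionConormalHom f f e he e he heW₁ heW₂ (𝟙 X) (Category.id_comp f) (Category.comp_id e) k₁ hk₁ hW₁ hhk₁ =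
      sectionConormalHom f f e he e he heW₁ heW₂ (𝟙 X) (Category.id_comp f) (Category.comp_id e) k₁ hk₁ hW₁ hhk₁ ∘ₗ sectionConormalEndo f e he heW₂ v hv hev h₂ hh₂v hW₂ hh₂ := by
  -- a shrinking element for `v` read from `W₂` into `W₁`: `D(h₀) ⊆ v⁻¹W₂`
  obtain ⟨h₀, hh₀, hh₀v⟩ := exists_sectionAug_eq_one_and_basicOpen_le f e he heW₁ hW₁ (v ⁻¹ᵁ W₂) (by rw [← Scheme.Hom.comp_preimage, hev, heW₂])
  rw [← sectionConormalHom_eq_sectionConormalEndo, ← sectionConormalHom_eq_sectionConormalEndo,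
    sectionConormalHom_comp f f f e he e he e he heW₁ heW₁ heW₂ hW₁ hW₁ v hv hev (𝟙 X) (Category.id_comp f) (Category.comp_id e) h₁ hh₁v hh₁ k₁ hk₁ hhk₁ h₀
      (by rw [Category.comp_id]; exact hh₀v) hh₀,
    sectionConormalHom_comp f f f e he e he e he heW₁ heW₂ heW₂ hW₁ hW₂ (𝟙 X) (Category.id_comp f) (Category.comp_id e) v hv hev k₁ hk₁ hhk₁ h₂ hh₂v hh₂ h₀
      (by rw [Category.id_comp]; exact hh₀v) hh₀,
    sectionConormalHom_congr f f e he e he heW₁ heW₂ hW₁ (Category.comp_id v) _ hv _ hev h₀ _ hh₀v hh₀,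
    sectionConormalHom_congr f f e he e he heW₁ heW₂ hW₁ (Category.id_comp v) _ hv _ hev h₀ _ hh₀v hh₀]

include hW₁ hk₁ hhk₁ hhk₂ hW₂ hk₂ in
/-- **`Module.Free` TRANSPORTS between charts of the section.** [cite: GortzWedhorn2023, (17.3)] -/
theorem free_cotangent_sectionAug_of_chart [Module.Free R (augIdeal (sectionAug f e he heW₂)).Cotangent] :
    Module.Free R (augIdeal (sectionAug f e he heW₁)).Cotangent :=
  Module.Free.of_equiv (LinearEquiv.ofBijective _ (sectionConormalHom_id_bijective f e he heW₁ heW₂ hW₁ hW₂ k₁ hk₁ hhk₁ k₂ hk₂ hhk₂))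

include hW₁ hk₁ hhk₁ hhk₂ hW₂ hk₂ in
/-- **`Module.Finite` TRANSPORTS between charts of the section.** [cite: GortzWedhorn2023, (17.3)] -/
theorem finite_cotangent_sectionAug_of_chart [Module.Finite R (augIdeal (sectionAug f e he heW₂)).Cotangent] :
    Module.Finite R (augIdeal (sectionAug f e he heW₁)).Cotangent :=
  Module.Finite.equiv (LinearEquiv.ofBijective _ (sectionConormalHom_id_bijective f e he heW₁ heW₂ hW₁ hW₂ k₁ hk₁ hhk₁ k₂ hk₂ hhk₂))

include hhk₁ hhk₂ hW₂ hk₂ k₁ hk₁ in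
/-- **INDEPENDENCE OF THE CHART FOR THE CHARACTERISTIC POLYNOMIAL**: for two affine charts `W₁, W₂` of the section with free finite conormal modules and ANY `R`-endomorphism `v`
fixing the section (arbitrary shrinking elements), `char(γ_v | I_{W₁}∕I²) = char(γ_v | I_{W₂}∕I²)` — the polynomial the chart-local Kottwitz condition reads does not depend on the
chart (`LinearEquiv.charpoly_conj` along the bijective intertwining comparison map). [cite: GortzWedhorn2023, (17.3) and Remark 17.14] [cite: Kottwitz1992, §5 p. 390] -/
theorem charpoly_sectionConormalEndo_eq_of_charts [Module.Free R (augIdeal (sectionAug f e he heW₁)).Cotangent] [Module.Finite R (augIdeal (sectionAug f e he heW₁)).Cotangent]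
    [Module.Free R (augIdeal (sectionAug f e he heW₂)).Cotangent] [Module.Finite R (augIdeal (sectionAug f e he heW₂)).Cotangent]
    (v : X ⟶ X) (hv : v ≫ f = f) (hev : e ≫ v = e)
    (h₁ : ChartRing f W₁) (hh₁v : X.basicOpen (val h₁) ≤ v ⁻¹ᵁ W₁) (hh₁ : sectionAug f e he heW₁ h₁ = 1)
    (h₂ : ChartRing f W₂) (hh₂v : X.basicOpen (val h₂) ≤ v ⁻¹ᵁ W₂) (hh₂ : sectionAug f e he heW₂ h₂ = 1) :
    (sectionConormalEndo f e he heW₁ v hv hev h₁ hh₁v hW₁ hh₁).charpoly = (sectionConormalEndo f e he heW₂ v hv hev h₂ hh₂v hW₂ hh₂).charpoly := by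
  set c := LinearEquiv.ofBijective _ (sectionConormalHom_id_bijective f e he heW₁ heW₂ hW₁ hW₂ k₁ hk₁ hhk₁ k₂ hk₂ hhk₂) with hc
  have hconj : sectionConormalEndo f e he heW₁ v hv hev h₁ hh₁v hW₁ hh₁ = c.conj (sectionConormalEndo f e he heW₂ v hv hev h₂ hh₂v hW₂ hh₂) := by
    apply LinearMap.ext
    intro y
    obtain ⟨x, rfl⟩ := c.surjective y
    rw [LinearEquiv.conj_apply, LinearMap.comp_apply, LinearMap.comp_apply, LinearEquiv.coe_coe, LinearEquiv.coe_coe, LinearEquiv.symm_apply_apply]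
    have := LinearMap.congr_fun (sectionConormalEndo_comp_sectionConormalHom_id f e he heW₁ heW₂ hW₁ hW₂ k₁ hk₁ hhk₁ v hv hev h₁ hh₁v hh₁ h₂ hh₂v hh₂) x
    simpa only [LinearMap.comp_apply, hc, LinearEquiv.ofBijective_apply] using this
  rw [hconj, LinearEquiv.charpoly_conj]

end TwoCharts

end Literature.AlgebraicGeometry.Morphisms

end
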